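import Literature.NumberTheory.LFunctions.SuzukiCanonicalSystem
import HarnessLib

/-!
# Suzuki's functions `φ_t^{±}` / `φ^{±}(t,x)`: the solutions of the integral equations (3.4), extended by (3.7)

M. Suzuki, *Hamiltonians arising from L-functions in the Selberg class*, J. Funct. Anal. **281** (2021)
109116 = arXiv:1606.05726 [Suzuki2021Hamiltonians], §3.3, AS PRINTED:

> **Lemma 3.3.** Let `ε ∈ {±1}` and `t ∈ (0,τ)`. Then the integral equation
> `X(x) + ε·1_{(−∞,t]}(x) ∫_{−∞}^{t} K(x+y) X(y) dy = 1_{(−∞,t]}(x) K(x+t)`  (3.4)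
> has the unique solution `X = φ_t^ε` in `L²(−∞,t)`. The solution `φ_t^ε` is a real-valued continuous
> function on `(−∞,t]` vanishing on `(−∞,−t)`. *Proof.* By the assumption for `E`, `𝖪[t]` is a compact
> operator on `L²(−∞,t)` such that both `±1` belong to its resolvent set. Therefore (3.4) has the unique
> solution `φ_t^ε` in `L²(−∞,t)` by the Fredholm alternative. …
> **Lemma 3.4** … the solution is extended to `(−∞,s]` by
> `φ̃_t^ε(x) = 1_{(−∞,s]}(x)K(x+t) − ε·1_{(−∞,s]}(x) ∫_{−∞}^{t} K(x+y) φ_t^ε(y) dy`  (3.6) …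
> In what follows, we denote by `φ^ε(t,x)` the extension of `φ_t^ε(x)` to `ℝ` …, that is,
> `φ^ε(t,x) = K(x+t) − ε ∫_{−∞}^{t} K(x+y) φ_t^ε(y) dy`  (3.7) …
> We take the convention that `φ^ε(0,x) = K(x)`. … `φ^ε(t,x)` is the unique continuous solution of
> `φ^ε(t,x) + ε ∫_{−∞}^{t} K(x+y) φ^ε(t,y) dy = K(x+t)`  (3.8).

## What this file provides (DEFINITIONS with bodies + unfolding API; no named facts)

This is the «construction C2» asked for by the de Branges/DBR column (pub/rh-dbr TARGET-v9 §M.2: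
`suzukiPhiPlus/Minus ω ν t : ℝ → ℝ`, the `L²(−∞,t)` solutions of (3.4) extended by (3.7)), for a GENERAL
real kernel `K` (Suzuki's (K2)–(K4) setting) and then specialised to the tree's `suzukiKernel ω ν`
(`SuzukiCanonicalSystem.lean`, (2.6)):

* `IsSuzukiPhiSolution K ε t X` — `X ∈ L²((−∞,t])` and (3.4) holds at EVERY `x ≤ t` (the printed solution
  is continuous on `(−∞,t]`, Lemma 3.3, so we ask for the pointwise equation there; this pins the
  representative).
* `suzukiPhiExt K ε t : ℝ → ℝ` — if (3.4) has a solution, the function (3.7) built from (a choice of) one;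
  otherwise `0`. When the `L²((−∞,t])`-solution is unique up to null sets (Suzuki's (K5), i.e. the tree's
  `NoUnitEigenvalue`-type hypothesis, supplied by the user as `huniq`), `suzukiPhiExt` does not depend on the
  choice and agrees with every solution on `(−∞,t]` (`IsSuzukiPhiSolution.eq_suzukiPhiExt`).
* proved API: `suzukiPhiExt_eq` ((3.7)/(3.8) on all of `ℝ`), `isSuzukiPhiSolution_suzukiPhiExt` (the extension
  restricts to a solution of (3.4)), `suzukiPhiExt_eq_zero_of_lt_neg` (vanishing on `(−∞,−t)` under (K3)),
  `suzukiPhiExt_zero_eq` (the convention `φ^ε(0,·) = K` is automatic under (K3)), `suzukiPhiExt_of_not_exists`.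
* `suzukiPhiPlus ω ν t := suzukiPhiExt (suzukiKernel ω ν) 1 t`, `suzukiPhiMinus ω ν t := suzukiPhiExt (suzukiKernel ω ν) (−1) t`.

Existence/uniqueness themselves (Lemma 3.3: Fredholm alternative under (K5)) are NOT asserted here — no
new `Prop` facts; users carry `(h : ∃ X, IsSuzukiPhiSolution K ε t X)` and the a.e.-uniqueness hypothesis
explicitly, exactly as the DBR column's `StringSlice` interface does.

## References
* [Suzuki2021Hamiltonians] M. Suzuki, J. Funct. Anal. 281 (2021) 109116, §3.1 (K1)–(K5), §3.3 Lemma 3.3,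
  Lemma 3.4, eqs. (3.4)–(3.8).
-/

noncomputable section

open MeasureTheory Set

namespace Literature.NumberTheory.LFunctions

/-! ### The integral equation (3.4) and its extended solution (3.7) -/

/-- `X` solves Suzuki's integral equation (3.4) at time `t` with sign `ε`:
`X ∈ L²((−∞,t])` and `X(x) + ε ∫_{(−∞,t]} K(x+y) X(y) dy = K(x+t)` for every `x ≤ t`.
[cite: Suzuki2021Hamiltonians, Lemma 3.3, eq. (3.4)] -/
def IsSuzukiPhiSolution (K : ℝ → ℝ) (ε t : ℝ) (X : ℝ → ℝ) : Prop :=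
  MemLp X 2 (volume.restrict (Iic t)) ∧
    ∀ x, x ≤ t → X x + ε * ∫ y in Iic t, K (x + y) * X y = K (x + t)

open Classical in
/-- Suzuki's extended solution `φ^ε(t,x) = K(x+t) − ε ∫_{(−∞,t]} K(x+y) φ_t^ε(y) dy` (3.7), built from a
solution `φ_t^ε` of (3.4) when one exists (value `0` otherwise). [cite: Suzuki2021Hamiltonians, Lemma 3.4, eq. (3.7)] -/
def suzukiPhiExt (K : ℝ → ℝ) (ε t : ℝ) : ℝ → ℝ := fun x =>
  if h : ∃ X, IsSuzukiPhiSolution K ε t X then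
    K (x + t) - ε * ∫ y in Iic t, K (x + y) * h.choose y
  else 0

/-- No solution ⇒ `suzukiPhiExt = 0` (junk value). [cite: Suzuki2021Hamiltonians, Lemma 3.3 (convention of this file)] -/
theorem suzukiPhiExt_of_not_exists {K : ℝ → ℝ} {ε t : ℝ} (h : ¬∃ X, IsSuzukiPhiSolution K ε t X) :
    suzukiPhiExt K ε t = 0 := by
  funext x
  simp [suzukiPhiExt, h]

/-- With a solution in hand, `suzukiPhiExt` is literally formula (3.7) for the chosen solution.
[cite: Suzuki2021Hamiltonians, eq. (3.7)] -/
private theorem suzukiPhiExt_of_exists {K : ℝ → ℝ} {ε t : ℝ} (h : ∃ X, IsSuzukiPhiSolution K ε t X)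
    (x : ℝ) : suzukiPhiExt K ε t x = K (x + t) - ε * ∫ y in Iic t, K (x + y) * h.choose y := by
  simp [suzukiPhiExt, h]

/-- On `(−∞,t]` the extension agrees with the chosen solution («clearly `φ̃_t^ε = φ_t^ε` on `(−∞,t]`»).
[cite: Suzuki2021Hamiltonians, Lemma 3.4 (proof)] -/
private theorem suzukiPhiExt_eq_choose {K : ℝ → ℝ} {ε t : ℝ} (h : ∃ X, IsSuzukiPhiSolution K ε t X)
    {x : ℝ} (hx : x ≤ t) : suzukiPhiExt K ε t x = h.choose x := by
  rw [suzukiPhiExt_of_exists h]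
  have := h.choose_spec.2 x hx
  linarith

/-- **(3.7) = (3.8) on all of `ℝ`:** if (3.4) is solvable, then for every real `x`,
`φ^ε(t,x) = K(x+t) − ε ∫_{(−∞,t]} K(x+y) φ^ε(t,y) dy`. [cite: Suzuki2021Hamiltonians, eqs. (3.7), (3.8)] -/
theorem suzukiPhiExt_eq {K : ℝ → ℝ} {ε t : ℝ} (h : ∃ X, IsSuzukiPhiSolution K ε t X) (x : ℝ) :
    suzukiPhiExt K ε t x = K (x + t) - ε * ∫ y in Iic t, K (x + y) * suzukiPhiExt K ε t y := by
  rw [suzukiPhiExt_of_exists h x]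
  congr 2
  refine setIntegral_congr_fun measurableSet_Iic fun y hy => ?_
  simp only [mem_Iic] at hy
  rw [suzukiPhiExt_eq_choose h hy]

/-- **The extension restricts to a solution of (3.4)** (Lemma 3.3/3.4: `φ^ε(t,·)|_{(−∞,t]} = φ_t^ε`).
[cite: Suzuki2021Hamiltonians, Lemma 3.3, Lemma 3.4] -/
theorem isSuzukiPhiSolution_suzukiPhiExt {K : ℝ → ℝ} {ε t : ℝ} (h : ∃ X, IsSuzukiPhiSolution K ε t X) :
    IsSuzukiPhiSolution K ε t (suzukiPhiExt K ε t) := by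
  refine ⟨?_, fun x hx => ?_⟩
  · have hae : h.choose =ᵐ[volume.restrict (Iic t)] suzukiPhiExt K ε t :=
      ae_restrict_of_forall_mem measurableSet_Iic fun y hy => (suzukiPhiExt_eq_choose h hy).symm
    exact h.choose_spec.1.ae_eq hae
  · rw [suzukiPhiExt_eq h x]
    ring

/-- **Uniqueness transfer:** if the `L²((−∞,t])`-solution of (3.4) is unique up to null sets (Suzuki's
(K5): `±1` not eigenvalues of `𝖪[t]`, Fredholm alternative), then EVERY solution agrees with `suzukiPhiExt`
pointwise on `(−∞,t]`; in particular `suzukiPhiExt` does not depend on the choice made in its definition.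
[cite: Suzuki2021Hamiltonians, Lemma 3.3 (uniqueness), (K5)] -/
theorem IsSuzukiPhiSolution.eq_suzukiPhiExt {K : ℝ → ℝ} {ε t : ℝ} {X : ℝ → ℝ}
    (hX : IsSuzukiPhiSolution K ε t X)
    (huniq : ∀ X Y : ℝ → ℝ, IsSuzukiPhiSolution K ε t X → IsSuzukiPhiSolution K ε t Y →
      X =ᵐ[volume.restrict (Iic t)] Y)
    {x : ℝ} (hx : x ≤ t) : X x = suzukiPhiExt K ε t x := by
  have h : ∃ X, IsSuzukiPhiSolution K ε t X := ⟨X, hX⟩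
  have hint : ∫ y in Iic t, K (x + y) * X y = ∫ y in Iic t, K (x + y) * suzukiPhiExt K ε t y := by
    refine integral_congr_ae ?_
    filter_upwards [huniq X _ hX (isSuzukiPhiSolution_suzukiPhiExt h)] with y hy
    rw [hy]
  rw [suzukiPhiExt_eq h x, ← hint]
  have := hX.2 x hx
  linarith

/-- **Vanishing on `(−∞,−t)` under (K3)** («`φ_t^ε` … vanishing on `(−∞,−t)`»; here for the extension,
whose defining integrand `K(x+y)`, `y ≤ t`, vanishes when `x < −t`). [cite: Suzuki2021Hamiltonians, Lemma 3.3, (K3)] -/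
theorem suzukiPhiExt_eq_zero_of_lt_neg {K : ℝ → ℝ} (hK3 : ∀ x, x < 0 → K x = 0) {ε t x : ℝ}
    (hx : x < -t) : suzukiPhiExt K ε t x = 0 := by
  by_cases h : ∃ X, IsSuzukiPhiSolution K ε t X
  · rw [suzukiPhiExt_of_exists h x, hK3 _ (by linarith), setIntegral_eq_zero_of_forall_eq_zero]
    · simp
    · intro y hy
      simp only [mem_Iic] at hy
      rw [hK3 _ (by linarith), zero_mul]
  · simp [suzukiPhiExt_of_not_exists h]

/-- **The convention `φ^ε(0,x) = K(x)` is automatic under (K3)** (with `K(0) = 0`, as for a continuous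
kernel vanishing on `(−∞,0)`): at `t = 0` equation (3.4) reads `X = 1_{(−∞,0]}K` and (3.7) gives `K`.
[cite: Suzuki2021Hamiltonians, §3.3 (convention after (3.7))] -/
theorem suzukiPhiExt_zero_eq {K : ℝ → ℝ} (hK3 : ∀ x, x ≤ 0 → K x = 0) (ε x : ℝ) :
    suzukiPhiExt K ε 0 x = K x := by
  -- `X := 1_{(−∞,0]} K = 0` on `(−∞,0]` solves (3.4) at `t = 0`
  have hsol : IsSuzukiPhiSolution K ε 0 (fun _ => 0) := by
    refine ⟨?_, fun y hy => ?_⟩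
    · exact MemLp.zero
    · simp [hK3 y (by simpa using hy)]
  have h : ∃ X, IsSuzukiPhiSolution K ε 0 X := ⟨_, hsol⟩
  rw [suzukiPhiExt_eq h x, add_zero, setIntegral_eq_zero_of_forall_eq_zero]
  · simp
  · intro y hy
    simp only [mem_Iic] at hy
    rw [suzukiPhiExt_eq h y, add_zero, hK3 y hy, setIntegral_eq_zero_of_forall_eq_zero]
    · simp
    · intro z hz
      simp only [mem_Iic] at hz
      rw [hK3 _ (by linarith), zero_mul]

/-! ### The `ζ` specialisation: `φ^{±}` for the kernel `K_ζ^{ω,ν}` -/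

/-- `φ^{+}(t,·)` for Suzuki's kernel `K_ζ^{ω,ν}`: the extended (3.7) solution of (3.4) with `ε = +1`.
[cite: Suzuki2021Hamiltonians, §2 (2.6)–(2.9) with Lemma 3.3, eq. (3.7)] -/
def suzukiPhiPlus (ω : ℝ) (ν : ℕ) (t : ℝ) : ℝ → ℝ :=
  suzukiPhiExt (suzukiKernel ω ν) 1 t

/-- `φ^{−}(t,·)` for Suzuki's kernel `K_ζ^{ω,ν}`: the extended (3.7) solution of (3.4) with `ε = −1`.
[cite: Suzuki2021Hamiltonians, §2 (2.6)–(2.9) with Lemma 3.3, eq. (3.7)] -/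
def suzukiPhiMinus (ω : ℝ) (ν : ℕ) (t : ℝ) : ℝ → ℝ :=
  suzukiPhiExt (suzukiKernel ω ν) (-1) t

/-- Unfolding. [cite: Suzuki2021Hamiltonians, eq. (3.7)] -/
theorem suzukiPhiPlus_def (ω : ℝ) (ν : ℕ) (t : ℝ) :
    suzukiPhiPlus ω ν t = suzukiPhiExt (suzukiKernel ω ν) 1 t := rfl

/-- Unfolding. [cite: Suzuki2021Hamiltonians, eq. (3.7)] -/
theorem suzukiPhiMinus_def (ω : ℝ) (ν : ℕ) (t : ℝ) :
    suzukiPhiMinus ω ν t = suzukiPhiExt (suzukiKernel ω ν) (-1) t := rfl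

/-- (3.8) for `φ^{+}`: `φ⁺(t,x) + ∫_{(−∞,t]} K(x+y) φ⁺(t,y) dy = K(x+t)` on all of `ℝ`, whenever (3.4) is
solvable. [cite: Suzuki2021Hamiltonians, eq. (3.8)] -/
theorem suzukiPhiPlus_eq {ω : ℝ} {ν : ℕ} {t : ℝ}
    (h : ∃ X, IsSuzukiPhiSolution (suzukiKernel ω ν) 1 t X) (x : ℝ) :
    suzukiPhiPlus ω ν t x + ∫ y in Iic t, suzukiKernel ω ν (x + y) * suzukiPhiPlus ω ν t y =
      suzukiKernel ω ν (x + t) := by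
  rw [suzukiPhiPlus_def, suzukiPhiExt_eq h x]
  ring

/-- (3.8) for `φ^{−}`: `φ⁻(t,x) − ∫_{(−∞,t]} K(x+y) φ⁻(t,y) dy = K(x+t)` on all of `ℝ`, whenever (3.4) is
solvable. [cite: Suzuki2021Hamiltonians, eq. (3.8)] -/
theorem suzukiPhiMinus_eq {ω : ℝ} {ν : ℕ} {t : ℝ}
    (h : ∃ X, IsSuzukiPhiSolution (suzukiKernel ω ν) (-1) t X) (x : ℝ) :
    suzukiPhiMinus ω ν t x - ∫ y in Iic t, suzukiKernel ω ν (x + y) * suzukiPhiMinus ω ν t y =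
      suzukiKernel ω ν (x + t) := by
  rw [suzukiPhiMinus_def, suzukiPhiExt_eq h x]
  ring

end Literature.NumberTheory.LFunctions
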